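import Literature.Topology.Immersions.OpenParallelizableImmersionProofs
import HarnessLib

/-!
# Open parallelizable manifolds immerse in `ℝⁿ`: the problem read in a global frame

Topic `Literature/Topology/Immersions`; companion of `OpenParallelizableImmersion.lean` (the named
fact `Literature.Topology.Immersions.Phillips1967_exists_isLocalDiffeomorph_of_isParallelizable`,
Phillips 1967, Cor. 8.2, "if" direction) and of `OpenParallelizableImmersionProofs.lean`
(reductions, `n ≤ 1`). Everything here is **proved**; no definitions, no named facts.

Phillips deduces Cor. 8.2 from his Theorem B (*the gradient map `∇ : Sub(M, ℝᵖ) → Sect TₚM` is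
a weak homotopy equivalence for open `M`*, §7 p. 195) at `p = n`: a section of the `n`-frame
bundle `TₙM` is a parallelization, and `π₀`-surjectivity of `∇` produces a submersion. This file
records the dictionary between the two languages which the tree's statement uses implicitly, in
the form in which an inductive proof over an exhaustion of `M` can be run **without frame bundles
or function-space topologies**: once a continuous global frame `σ = (σᵢ)` of `TM` is fixed, the
differential of a map `f : M → ℝⁿ` is encoded by the family of vectors
`(d f_x (σᵢ x))ᵢ` in `ℝⁿ` — the matrix of `d f_x` in the basis `σ(x)` — and

* `Literature.Topology.Immersions.isInvertible_of_linearIndependent_map` — a continuous linear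
  endomorphism of a finite-dimensional space mapping some family of `finrank` vectors to a
  linearly independent family is invertible (linear algebra);
* `Literature.Topology.Immersions.isLocalDiffeomorph_of_linearIndependent_mfderiv_apply` — hence a
  `C^∞` map `f : M → ℝⁿ` such that the vectors `d f_x (σᵢ x)`, `i < n`, are linearly independent
  at every point is a local diffeomorphism (inverse function theorem, the tree's
  `isLocalDiffeomorph_iff_isInvertible_mfderiv`); conversely
  `linearIndependent_mfderiv_apply_of_isLocalDiffeomorphAt`;
* `Literature.Topology.Immersions.continuous_mfderiv_apply_of_continuous_section` — for `f` of
  class `C¹` and a continuous vector field `v` (a continuous section of `TM`), the map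
  `x ↦ d f_x (v x) ∈ ℝⁿ` is continuous (it is the second component of `Tf ∘ v`, and `Tℝⁿ = ℝⁿ × ℝⁿ`);
  this is the continuity of Phillips' gradient section `∇f ∈ Sect TₙM` (§7, p. 195);
* `Literature.Topology.Immersions.Phillips1967_exists_isLocalDiffeomorph_of_isParallelizable_of_frame`
  — **reduction of the fact to its frame form**: it suffices to prove, for every connected
  non-compact `C^∞` `n`-manifold `M`, `2 ≤ n`, carrying `n` continuous vector fields `σᵢ` which
  are linearly independent at each point, that there is a `C^∞` map `f : M → ℝⁿ` with
  `(d f_x (σᵢ x))ᵢ` linearly independent at each point (Phillips' `π₀`-surjectivity of `∇` at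
  `p = n`, §8 Cor. 8.2 from Thm. B; the cases `n ≤ 1` and the reduction to connected `M` are the
  tree's `Phillips1967_exists_isLocalDiffeomorph_of_isParallelizable_of_le_one` and
  `Phillips1967_exists_isLocalDiffeomorph_of_isParallelizable_of_connected`).

## References

* A. Phillips, *Submersions of open manifolds*, Topology **6** (1967), 171–206: §7 (Thm. B,
  Lemma 7.1, p. 195), §8 Cor. 8.2 (p. 196). [Phillips1967]
* M. W. Hirsch, *Differential Topology*, GTM 33 (1976), Ch. 4 §2 (frames and trivialisations).
  [HirschDT1976]
-/

open scoped Manifold ContDiff Topology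
open Set Function Bundle Module

noncomputable section

namespace Literature.Topology.Immersions

open Literature.Topology.FourManifolds (IsParallelizable)

/-! ### Linear algebra: invertibility from the image of a frame -/

/-- A continuous linear endomorphism `A` of a finite-dimensional real normed space `E` which maps
some family of `finrank E` vectors to a linearly independent family is invertible: the images
span `E` (`LinearIndependent.span_eq_top_of_card_eq_finrank'`), so `A` is onto, hence one-to-one
(`LinearMap.injective_iff_surjective`), hence a continuous linear equivalence. [folklore] -/
theorem isInvertible_of_linearIndependent_map {E : Type*} [NormedAddCommGroup E]
    [NormedSpace ℝ E] [FiniteDimensional ℝ E] {ι : Type*} [Fintype ι]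
    (hι : Fintype.card ι = finrank ℝ E) (A : E →L[ℝ] E) {v : ι → E}
    (h : LinearIndependent ℝ fun i => A (v i)) : A.IsInvertible := by
  have hspan : Submodule.span ℝ (Set.range fun i => A (v i)) = ⊤ :=
    h.span_eq_top_of_card_eq_finrank' hι
  have hsurj : Surjective (A : E →ₗ[ℝ] E) := by
    rw [← LinearMap.range_eq_top, eq_top_iff, ← hspan, Submodule.span_le]
    rintro _ ⟨i, rfl⟩
    exact ⟨v i, rfl⟩
  have hinj : Injective (A : E →ₗ[ℝ] E) := LinearMap.injective_iff_surjective.2 hsurj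
  refine ⟨(LinearEquiv.ofInjectiveEndo (A : E →ₗ[ℝ] E) hinj).toContinuousLinearEquiv, ?_⟩
  ext x
  rfl

/-! ### Local diffeomorphisms `M → ℝⁿ` detected on a frame -/

section Frame

variable {n : ℕ} {M : Type*} [TopologicalSpace M] [ChartedSpace (EuclideanSpace ℝ (Fin n)) M]

/-- **A map whose differential sends a frame to frames is a local diffeomorphism.** Let `M` be a
`C^∞` manifold modelled on `ℝⁿ` and `σᵢ : M → T M`, `i : ι`, `card ι = n`, any family of vector
fields (no continuity needed here). If `f : M → ℝⁿ` is `C^∞` and at every point the vectors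
`d f_x (σᵢ x) ∈ ℝⁿ` are linearly independent, then `d f_x` is invertible
(`isInvertible_of_linearIndependent_map`), so `f` is a `C^∞` local diffeomorphism by the inverse
function theorem (the tree's `isLocalDiffeomorph_iff_isInvertible_mfderiv`). This is how a
submersion is recognised from its gradient `n`-frame `∇f ∈ Sect TₙM` (Phillips 1967, §7).
[cite: Phillips1967, §7, p. 195] -/
theorem isLocalDiffeomorph_of_linearIndependent_mfderiv_apply [IsManifold (𝓡 n) ∞ M]
    {ι : Type*} [Fintype ι] (hι : Fintype.card ι = n) {σ : ι → M → EuclideanSpace ℝ (Fin n)}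
    {f : M → EuclideanSpace ℝ (Fin n)} (hf : ContMDiff (𝓡 n) (𝓡 n) ∞ f)
    (h : ∀ x, LinearIndependent ℝ fun i => mfderiv (𝓡 n) (𝓡 n) f x (σ i x)) :
    IsLocalDiffeomorph (𝓡 n) (𝓡 n) ∞ f := by
  refine (isLocalDiffeomorph_iff_isInvertible_mfderiv (I := 𝓡 n) (J := 𝓡 n) (by norm_num)).2
    ⟨hf, fun x => ?_⟩
  exact isInvertible_of_linearIndependent_map (hι.trans finrank_euclideanSpace_fin.symm)
    (mfderiv (𝓡 n) (𝓡 n) f x) (h x)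

/-- Conversely, the differential of a `Cᵏ` local diffeomorphism at `x`, `k ≠ 0`, maps a basis of
`T_x M` — e.g. the value at `x` of a frame — to a linearly independent family of `ℝⁿ`
(`IsLocalDiffeomorphAt.mfderivToContinuousLinearEquiv`). [folklore] -/
theorem linearIndependent_mfderiv_apply_of_isLocalDiffeomorphAt [IsManifold (𝓡 n) 1 M]
    {k : WithTop ℕ∞} (hk : k ≠ 0) {ι : Type*} {σ : ι → M → EuclideanSpace ℝ (Fin n)}
    {f : M → EuclideanSpace ℝ (Fin n)} {x : M} (hf : IsLocalDiffeomorphAt (𝓡 n) (𝓡 n) k f x)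
    (hσ : LinearIndependent ℝ fun i => σ i x) :
    LinearIndependent ℝ fun i => mfderiv (𝓡 n) (𝓡 n) f x (σ i x) := by
  have key : LinearIndependent ℝ
      ((hf.mfderivToContinuousLinearEquiv hk).toLinearEquiv ∘ fun i => σ i x) :=
    hσ.map' (hf.mfderivToContinuousLinearEquiv hk).toLinearEquiv.toLinearMap
      (hf.mfderivToContinuousLinearEquiv hk).toLinearEquiv.ker
  convert key using 1
  funext i
  simp only [comp_apply]
  rw [← hf.mfderivToContinuousLinearEquiv_coe hk]
  rfl

/-! ### Continuity of `x ↦ d f_x (v x)` -/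

/-- **The gradient frame is a continuous section** (Phillips 1967, §7: `∇f ∈ Sect TₙM`). For a
`Cᵏ` map `f : M → ℝⁿ`, `1 ≤ k`, and a continuous vector field `v` on `M` (a continuous section of
the tangent bundle, in Mathlib's sense: `x ↦ ⟨x, v x⟩` continuous into `TangentBundle`), the map
`x ↦ d f_x (v x) ∈ ℝⁿ` is continuous: it is the second component (`Tℝⁿ ≅ ℝⁿ × ℝⁿ`,
`tangentBundleModelSpaceHomeomorph`) of the continuous map `Tf ∘ v`
(`ContMDiff.continuous_tangentMap`). [cite: Phillips1967, §7, p. 195] -/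
theorem continuous_mfderiv_apply_of_continuous_section [IsManifold (𝓡 n) 1 M] {k : WithTop ℕ∞}
    (hk : 1 ≤ k) {f : M → EuclideanSpace ℝ (Fin n)} (hf : ContMDiff (𝓡 n) (𝓡 n) k f)
    {v : M → EuclideanSpace ℝ (Fin n)}
    (hv : Continuous fun x => (⟨x, v x⟩ : TangentBundle (𝓡 n) M)) :
    Continuous fun x => mfderiv (𝓡 n) (𝓡 n) f x (v x) := by
  have h1 : Continuous (tangentMap (𝓡 n) (𝓡 n) f) := hf.continuous_tangentMap hk
  have h2 : Continuous fun p : TangentBundle (𝓡 n) (EuclideanSpace ℝ (Fin n)) => p.2 :=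
    (contMDiff_snd_tangentBundle_modelSpace (n := 0) (EuclideanSpace ℝ (Fin n))
      (𝓡 n)).continuous
  exact h2.comp (h1.comp hv)

/-- Joint continuity in a parameter: if `f : M → ℝⁿ` is `Cᵏ`, `1 ≤ k`, and `(p, x) ↦ v p x` is a
continuous family of tangent vectors (`(p, x) ↦ ⟨x, v p x⟩` continuous into `TangentBundle`, `p`
in any topological space `P`), then `(p, x) ↦ d f_x (v p x)` is continuous. [folklore] -/
theorem continuous_mfderiv_apply_of_continuous_family [IsManifold (𝓡 n) 1 M] {k : WithTop ℕ∞}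
    (hk : 1 ≤ k) {f : M → EuclideanSpace ℝ (Fin n)} (hf : ContMDiff (𝓡 n) (𝓡 n) k f)
    {P : Type*} [TopologicalSpace P] {v : P → M → EuclideanSpace ℝ (Fin n)}
    (hv : Continuous fun q : P × M => (⟨q.2, v q.1 q.2⟩ : TangentBundle (𝓡 n) M)) :
    Continuous fun q : P × M => mfderiv (𝓡 n) (𝓡 n) f q.2 (v q.1 q.2) := by
  have h1 : Continuous (tangentMap (𝓡 n) (𝓡 n) f) := hf.continuous_tangentMap hk
  have h2 : Continuous fun p : TangentBundle (𝓡 n) (EuclideanSpace ℝ (Fin n)) => p.2 :=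
    (contMDiff_snd_tangentBundle_modelSpace (n := 0) (EuclideanSpace ℝ (Fin n))
      (𝓡 n)).continuous
  exact h2.comp (h1.comp hv)

end Frame

/-! ### The fact in frame form -/

/-- **Reduction of Phillips' Cor. 8.2 ("if") to its frame form** (Cor. 8.2 from Thm. B, §8, with
the reductions already in the tree). To prove the named fact
`Literature.Topology.Immersions.Phillips1967_exists_isLocalDiffeomorph_of_isParallelizable` it
suffices to show: for every **connected, non-compact** `C^∞` manifold `M` (Hausdorff, second
countable) modelled on `ℝⁿ`, `2 ≤ n`, and every family of `n` continuous vector fields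
`σᵢ : M → TM` linearly independent at each point (a continuous global frame = a section of
`TₙM`), there is a `C^∞` map `f : M → ℝⁿ` such that the vectors `d f_x (σᵢ x)`, `i < n`, are
linearly independent at every `x` (i.e. `π₀`-surjectivity of Phillips' `∇` onto the component of
`σ`, forgetting the homotopy). Indeed such an `f` is a local diffeomorphism
(`isLocalDiffeomorph_of_linearIndependent_mfderiv_apply`); components of an open manifold are
connected non-compact and parallelizable
(`Phillips1967_exists_isLocalDiffeomorph_of_isParallelizable_of_connected`), and `n ≤ 1` is
settled (`Phillips1967_exists_isLocalDiffeomorph_of_isParallelizable_of_le_one`).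
[cite: Phillips1967, Cor. 8.2 (p. 196) and Thm. B (p. 195)] -/
theorem Phillips1967_exists_isLocalDiffeomorph_of_isParallelizable_of_frame
    (h : ∀ (n : ℕ) (M : Type) [TopologicalSpace M] [T2Space M] [SecondCountableTopology M]
      [ChartedSpace (EuclideanSpace ℝ (Fin n)) M] [IsManifold (𝓡 n) ∞ M] [ConnectedSpace M]
      [NoncompactSpace M] (σ : Fin n → M → EuclideanSpace ℝ (Fin n)),
      2 ≤ n →
      (∀ i, Continuous fun x => (⟨x, σ i x⟩ : TangentBundle (𝓡 n) M)) →
      (∀ x, LinearIndependent ℝ fun i => σ i x) →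
        ∃ f : M → EuclideanSpace ℝ (Fin n), ContMDiff (𝓡 n) (𝓡 n) ∞ f ∧
          ∀ x, LinearIndependent ℝ fun i => mfderiv (𝓡 n) (𝓡 n) f x (σ i x)) :
    Phillips1967_exists_isLocalDiffeomorph_of_isParallelizable := by
  refine Phillips1967_exists_isLocalDiffeomorph_of_isParallelizable_of_connected
    fun n M _ _ _ _ _ _ _ hpar => ?_
  rcases le_or_gt n 1 with hn | hn
  · haveI : LocallyConnectedSpace M :=
      ChartedSpace.locallyConnectedSpace (EuclideanSpace ℝ (Fin n)) M
    exact Phillips1967_exists_isLocalDiffeomorph_of_isParallelizable_of_le_one n hn M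
      (fun x => not_isCompact_connectedComponent_of_noncompactSpace x) hpar
  · -- reindex the frame by `Fin n` (`finrank ℝ ℝⁿ = n`) and apply `h`
    obtain ⟨s, hs, hli⟩ := hpar
    have hN : finrank ℝ (EuclideanSpace ℝ (Fin n)) = n := finrank_euclideanSpace_fin
    let e : Fin n ≃ Fin (finrank ℝ (EuclideanSpace ℝ (Fin n))) := finCongr hN.symm
    obtain ⟨f, hf, hf'⟩ := h n M (fun i => s (e i)) hn (fun i => hs (e i))
      (fun x => (hli x).comp e e.injective)
    exact ⟨f, isLocalDiffeomorph_of_linearIndependent_mfderiv_apply (Fintype.card_fin n) hf hf'⟩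

end Literature.Topology.Immersions
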